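import Summits.ResolutionOfSingularities.ResolutionOfSingularities.Theorems.StallVertexWalk
import HarnessLib

/-!
# StallVertexClasses — decomp-res node «StallVertex» (lens-5 g20), tree file 4/5 of the node

Content VERBATIM from the decomp-res lens-5 g20 file
`HOME/decomp-res-lens-5/g20/parts/StallVertex-g20-0349e14d.lean` (sha256 0349e14dd83eb816, 869 l;
the CLEARED pin — the lens's later rev 1 d60a69dd «stall rigidity» is a superset awaiting its own critic row;
HOME = run/shared/lean/pub/decomp-res).
Critic: CRITIC-LEDGER row 142 (CLEARED 2026-08-30T20:41:19Z, DECIDED +1: the STALL VERTEX LAW `stall_vertex` in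
kernel, hypothesis-free).  Split per the
critic's order (§1–§2 halved for the 400-line limit; the three BY-NAME theorems on
`MaxContactCut.DefectWalksDeep` moved to the wiring file).  Landed by
decomp-res writer g7 in the lens's namespace `…Theorems.StallVertex`; every file of the node is in the Theses cone
(the lens imports the in-cone
`DifferentialShade` for `ifp` / `muTilde`), so the located residual `NoVertexBoundSkewStalledTailsDeep` cannot be
imported by the route file: it is
booked by RE-LOCATING the existing aside 28122 `CFNoSkewJointTailsDeep` (EXACTLY ⟺ it, hypothesis-free:
`skew_iff_vertexBound`) — one aside, not two.

§4 `Classes` (l. 662–866) minus the three BY-NAME theorems on `MaxContactCut.DefectWalksDeep` (→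
`MaxContactCutStallVertex`): the DECIDED classes
`NoPositiveOffConeStalledTailsDeep` / `NoPositiveOffConeSkewTailsDeep` (+ `_holds`), THE LOCATED RESIDUAL
`NoVertexBoundSkewStalledTailsDeep` with the
EXACT hypothesis-free re-location `skew_iff_vertexBound : CoefficientCut.NoSkewJointTailsDeep ↔
NoVertexBoundSkewStalledTailsDeep`, `joint_iff_planar_skew`,
`joint_iff_planar_vertexBound`, the split beneath the residual (`NoMonomialSkewStalledTailsDeep`,
`NoPositiveOnConeSkewStalledTailsDeep`,
`vertexBound_iff_monomial_onCone`).  In the Theses cone via `DifferentialShade` (hence the residual is booked on the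
route by re-locating aside 28122).

[WRITER NOTE (decomp-res writer g7): file split only; namespace, opens, section variables and every declaration
exactly as in the lens (global `set_option` dropped).]

(Sources: KawanoueMatsuki2016 §4.1; Hauser2010; HauserPerlega2024; Moh1987; CossartPiltant2008; Giraud1975; Hironaka1964.)
-/

noncomputable section

open MvPolynomial Finset
open Literature.AlgebraicGeometry.Resolution
open Literature.AlgebraicGeometry.Resolution.Hauser2010
open Literature.AlgebraicGeometry.Resolution.HauserPerlega2024
open Literature.Barriers.ResolutionOfSingularities
open Literature.AlgebraicGeometry.Resolution.PointBlowup
open Summit.ResolutionOfSingularities.ResolutionOfSingularities.Theses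
open Summit.ResolutionOfSingularities.ResolutionOfSingularities.Theorems.TightDefectClasses
open Summit.ResolutionOfSingularities.ResolutionOfSingularities.Theorems.ProximityCut
open Summit.ResolutionOfSingularities.ResolutionOfSingularities.Theorems.ExitLaw
open Summit.ResolutionOfSingularities.ResolutionOfSingularities.Theorems.DifferentialShade

namespace Summit.ResolutionOfSingularities.ResolutionOfSingularities.Theorems.StallVertex

/-! ## §4 Classes and the EXACT node -/

section Classes

/-- **DECIDED (PROVED, every `e`, every field of characteristic `p`): NO OFF-CONE STALLED TAILS OF POSITIVE
DIFFERENTIAL SHADE.**  The joint residual's binders VERBATIM + «`μ̃` stalls from `N` on» + «`μ̃ > 0` from `N` on» +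
«infinitely many OFF-CONE moves».  Empty by the vertex law (`not_offConeAt_of_stall_pos`): under a stall with
`μ̃ > 0` every move heads INTO the tangent cone of every minimiser.  [new] -/
def NoPositiveOffConeStalledTailsDeep : Prop :=
  ∀ p : ℕ, p.Prime → ∀ e : ℕ, 2 ≤ e → ∀ (K : Type) [Field K] [CharP K p] [PerfectField K] [DecidableEq K]
    (s₀ : State (Fin 3) K), IsRoot (p ^ e) s₀ → ∀ W : ForcedWalk (p ^ e) s₀, (∀ i, 1 ≤ (W.st i).shade) →
    ∀ N : ℕ, (∀ t, N ≤ t → (W.st (t + 1)).shade = (W.st t).shade) →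
    (∀ t, N ≤ t → ordZero (W.st t).F ≠ ((p ^ e : ℕ) : ℕ∞)) →
    (∀ M : ℕ, ∃ t, M ≤ t ∧ StaysOnNewest W t) → (∀ M : ℕ, ∃ t, M ≤ t ∧ W.b t ≠ 0) →
    (∀ t, N ≤ t → (ifp W (t + 1)).muTilde (p ^ e) = (ifp W t).muTilde (p ^ e)) →
    (∀ t, N ≤ t → (0 : WithTop ℚ) < (ifp W t).muTilde (p ^ e)) →
    (∀ M : ℕ, ∃ t, M ≤ t ∧ OffConeAt W t) → False

/-- `noPositiveOffConeStalledTailsDeep_holds`: Auxiliary step of this node's calculus, VERBATIM from the lens file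
(see the module docstring); the statement is its type. [folklore] -/
theorem noPositiveOffConeStalledTailsDeep_holds : NoPositiveOffConeStalledTailsDeep := by
  intro p hp e _ K _ _ _ _ s₀ hs W _ N _ _ _ _ hstall hpos hoff
  obtain ⟨t, ht, hofft⟩ := hoff N
  exact not_offConeAt_of_stall_pos hp hs W t (hstall t ht).ge (hpos t ht) hofft

/-- **THE SAME CELL TYPED INSIDE THE SKEW RESIDUAL, WITHOUT THE STALL BINDER (DECIDED, PROVED EMPTY):** a joint tail
that is SKEW (binder of `CoefficientCut.NoSkewJointTailsDeep` verbatim), has POSITIVE differential shade from `N` on,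
and moves OFF-CONE infinitely often does not exist.  No stall hypothesis: `μ̃` settles on every root walk (tree
`DifferentialShade.muTilde_settles`), so the late off-cone moves happen at stalls, where the law forbids them.
A typed sub-class of `CoefficientCut.NoSkewJointTailsDeep` BY LETTER (`offConeSkew_of_skew`).  [new] -/
def NoPositiveOffConeSkewTailsDeep : Prop :=
  ∀ p : ℕ, p.Prime → ∀ e : ℕ, 2 ≤ e → ∀ (K : Type) [Field K] [CharP K p] [PerfectField K] [DecidableEq K]
    (s₀ : State (Fin 3) K), IsRoot (p ^ e) s₀ → ∀ W : ForcedWalk (p ^ e) s₀, (∀ i, 1 ≤ (W.st i).shade) →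
    ∀ N : ℕ, (∀ t, N ≤ t → (W.st (t + 1)).shade = (W.st t).shade) →
    (∀ t, N ≤ t → ordZero (W.st t).F ≠ ((p ^ e : ℕ) : ℕ∞)) →
    (∀ M : ℕ, ∃ t, M ≤ t ∧ StaysOnNewest W t) → (∀ M : ℕ, ∃ t, M ≤ t ∧ W.b t ≠ 0) →
    (∀ (k : Fin 3) (N' : ℕ), ∃ t, N' ≤ t ∧ (W.j t = k ∨ W.b t k ≠ 0)) →
    (∀ t, N ≤ t → (0 : WithTop ℚ) < (ifp W t).muTilde (p ^ e)) →
    (∀ M : ℕ, ∃ t, M ≤ t ∧ OffConeAt W t) → False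

/-- `noPositiveOffConeSkewTailsDeep_holds`: Auxiliary step of this node's calculus, VERBATIM from the lens file (see
the module docstring); the statement is its type. [folklore] -/
theorem noPositiveOffConeSkewTailsDeep_holds : NoPositiveOffConeSkewTailsDeep := by
  intro p hp e _ K _ _ _ _ s₀ hs W _ N _ _ _ _ _ hpos hoff
  obtain ⟨N₁, hN₁⟩ := muTilde_settles hp hs W
  obtain ⟨t, ht, hofft⟩ := hoff (max N N₁)
  exact not_offConeAt_of_stall_pos hp hs W t (hN₁ t (le_trans (le_max_right _ _) ht)).ge
    (hpos t (le_trans (le_max_left _ _) ht)) hofft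

/-- The decided cell sits inside the skew class by letter (dropping binders). [folklore] -/
theorem offConeSkew_of_skew (h : CoefficientCut.NoSkewJointTailsDeep) : NoPositiveOffConeSkewTailsDeep :=
  fun p hp e he K _ _ _ _ s₀ hs W hsh N hplat hexc hS hT hskew _ _ =>
    h p hp e he K s₀ hs W hsh N hplat hexc hS hT hskew

/-- **LOCATED RESIDUAL (UNDECIDED): VERTEX-BOUND SKEW STALLED TAILS.**  The joint residual's binders VERBATIM + the
SKEW binder of `CoefficientCut.NoSkewJointTailsDeep` (tree) + «`μ̃` stalls from `N` on» (tree `DifferentialShade`) +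
THE VERTEX LAW and THE ORIGIN LAW IN FORCE AT EVERY LATE MOVE.  EXACT: `CoefficientCut.NoSkewJointTailsDeep ↔` this
(`skew_iff_vertexBound`, hypothesis-free) — the law is fully spent in the binders, nothing is assumed.  Leaf:
IDEA-NEEDED (transport of the cone condition from one stalled state to the next: the census shows chart changes
under a stall only at PURE-POWER cones, 34/34, and clean transport in 1175/1260 edge–minimiser pairs) ∧
INSTRUMENTABLE (T-planar-7b: skew stretches; vertex census 1260/1260).  [new] -/
def NoVertexBoundSkewStalledTailsDeep : Prop :=
  ∀ p : ℕ, p.Prime → ∀ e : ℕ, 2 ≤ e → ∀ (K : Type) [Field K] [CharP K p] [PerfectField K] [DecidableEq K]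
    (s₀ : State (Fin 3) K), IsRoot (p ^ e) s₀ → ∀ W : ForcedWalk (p ^ e) s₀, (∀ i, 1 ≤ (W.st i).shade) →
    ∀ N : ℕ, (∀ t, N ≤ t → (W.st (t + 1)).shade = (W.st t).shade) →
    (∀ t, N ≤ t → ordZero (W.st t).F ≠ ((p ^ e : ℕ) : ℕ∞)) →
    (∀ M : ℕ, ∃ t, M ≤ t ∧ StaysOnNewest W t) → (∀ M : ℕ, ∃ t, M ≤ t ∧ W.b t ≠ 0) →
    (∀ (k : Fin 3) (N' : ℕ), ∃ t, N' ≤ t ∧ (W.j t = k ∨ W.b t k ≠ 0)) →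
    (∀ t, N ≤ t → (ifp W (t + 1)).muTilde (p ^ e) = (ifp W t).muTilde (p ^ e)) →
    (∀ t, N ≤ t → VertexLawAt W t) → (∀ t, N ≤ t → OriginLawAt W t) → False

/-- Trivial direction: the residual is a sub-case of the skew class BY LETTER. [folklore] -/
theorem vertexBound_of_skew (h : CoefficientCut.NoSkewJointTailsDeep) : NoVertexBoundSkewStalledTailsDeep :=
  fun p hp e he K _ _ _ _ s₀ hs W hsh N hplat hexc hS hT hskew _ _ _ =>
    h p hp e he K s₀ hs W hsh N hplat hexc hS hT hskew

/-- **Re-location, hypothesis-free:** shift `N` past the settling time of `μ̃` (tree `DifferentialShade.muTilde_settles`)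
and feed the laws (`vertexLawAt_of_stall`, `originLawAt_of_stall`). [folklore] -/
theorem skew_of_vertexBound (h : NoVertexBoundSkewStalledTailsDeep) : CoefficientCut.NoSkewJointTailsDeep := by
  intro p hp e he K _ _ _ _ s₀ hs W hsh N hplat hexc hS hT hskew
  obtain ⟨N₁, hN₁⟩ := muTilde_settles hp hs W
  have hst : ∀ t, max N N₁ ≤ t → (ifp W t).muTilde (p ^ e) ≤ (ifp W (t + 1)).muTilde (p ^ e) :=
    fun t ht => (hN₁ t (le_trans (le_max_right _ _) ht)).ge
  exact h p hp e he K s₀ hs W hsh (max N N₁) (fun t ht => hplat t (le_trans (le_max_left _ _) ht))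
    (fun t ht => hexc t (le_trans (le_max_left _ _) ht)) hS hT hskew
    (fun t ht => hN₁ t (le_trans (le_max_right _ _) ht))
    (fun t ht => vertexLawAt_of_stall hp hs W t (hst t ht))
    (fun t ht => originLawAt_of_stall hp hs W t (hst t ht))

/-- **EXACT re-location of the lens-5 located residual (g19 `CoefficientCut.NoSkewJointTailsDeep`, tree).** [folklore] -/
theorem skew_iff_vertexBound : CoefficientCut.NoSkewJointTailsDeep ↔ NoVertexBoundSkewStalledTailsDeep :=
  ⟨vertexBound_of_skew, skew_of_vertexBound⟩

/-- The planar / skew dichotomy of the joint residual (g19 `CoefficientCut.joint_iff_planar_skew`, re-proved here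
because the lens file is not importable; both classes are the tree's `CoefficientCutClasses`). [folklore] -/
theorem joint_iff_planar_skew :
    NoRepeatTranslationRecurrentExcessPlateauxDeep ↔
      CoefficientCut.NoPlanarJointTailsDeep ∧ CoefficientCut.NoSkewJointTailsDeep := by
  constructor
  · intro h
    exact ⟨fun p hp e he K _ _ _ _ s₀ hs W hsh N hplat hexc hS hT _ _ _ =>
        h p hp e he K s₀ hs W hsh N hplat hexc hS hT,
      fun p hp e he K _ _ _ _ s₀ hs W hsh N hplat hexc hS hT _ => h p hp e he K s₀ hs W hsh N hplat hexc hS hT⟩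
  · rintro ⟨hP, hS'⟩ p hp e he K _ _ _ _ s₀ hs W hsh N hplat hexc hS hT
    by_cases hpl : ∃ (k : Fin 3) (N' : ℕ), ∀ t, N' ≤ t → W.j t ≠ k ∧ W.b t k = 0
    · obtain ⟨k, N', hk⟩ := hpl
      exact hP p hp e he K s₀ hs W hsh N hplat hexc hS hT k N' hk
    · push Not at hpl
      refine hS' p hp e he K s₀ hs W hsh N hplat hexc hS hT fun k N' => ?_
      obtain ⟨t, ht, hkt⟩ := hpl k N'
      refine ⟨t, ht, ?_⟩
      by_cases hj : W.j t = k
      · exact Or.inl hj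
      · exact Or.inr (hkt hj)

/-- **THE NODE EQUATION (EXACT, hypothesis-free).** [folklore] -/
theorem joint_iff_planar_vertexBound :
    NoRepeatTranslationRecurrentExcessPlateauxDeep ↔
      CoefficientCut.NoPlanarJointTailsDeep ∧ NoVertexBoundSkewStalledTailsDeep := by
  rw [joint_iff_planar_skew, skew_iff_vertexBound]

/-! ### The split beneath the residual: the MONOMIAL regime (`μ̃ ≡ 0`) and the POSITIVE ON-CONE regime -/

/-- `μ̃ ≥ 0` along a forced walk from a root (tree `DifferentialShade.muTilde_lattice`). (Sources:
KawanoueMatsuki2016, §4.1.) -/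
theorem muTilde_nonneg {K : Type} [Field K] [DecidableEq K] {q : ℕ} {s₀ : State (Fin 3) K}
    (W : ForcedWalk q s₀) (t : ℕ) : (0 : WithTop ℚ) ≤ (ifp W t).muTilde q := by
  rcases muTilde_lattice q (ifp W t) (level_bounds W t) with h | ⟨z, hz⟩
  · rw [h]; exact le_top
  · rw [hz, ← WithTop.coe_zero, WithTop.coe_le_coe]
    exact div_nonneg (Nat.cast_nonneg _) (Nat.cast_nonneg _)

/-- A stalled `μ̃` is constant from `N` on. [folklore] -/
theorem muTilde_eq_of_stall {K : Type} [Field K] [DecidableEq K] {q : ℕ} {s₀ : State (Fin 3) K}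
    (W : ForcedWalk q s₀) {N : ℕ} (hst : ∀ t, N ≤ t → (ifp W (t + 1)).muTilde q = (ifp W t).muTilde q)
    {t : ℕ} (ht : N ≤ t) : (ifp W t).muTilde q = (ifp W N).muTilde q := by
  obtain ⟨m, rfl⟩ : ∃ m, t = N + m := ⟨t - N, by omega⟩
  induction m with
  | zero => rfl
  | succ m ih => rw [← Nat.add_assoc, hst (N + m) (Nat.le_add_right _ _), ih (Nat.le_add_right _ _)]

/-- **LEAF M · THE MONOMIAL REGIME (UNDECIDED):** vertex-bound skew stalled tails with `μ̃ ≡ 0` from `N` on —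
Kawanoue–Matsuki's MONOMIAL CASE of the unit (`μ_P = Σ_young μ_{P,D}`: the minimiser's initial form is, up to the
young monomial, of `μ_P`-value carried entirely by `E_young`). (Sources: KawanoueMatsuki2016, §4.1 and §5 (the monomial
case, `τ = 1`, dimension 3); new as a class of the forced-walk calculus.) -/
def NoMonomialSkewStalledTailsDeep : Prop :=
  ∀ p : ℕ, p.Prime → ∀ e : ℕ, 2 ≤ e → ∀ (K : Type) [Field K] [CharP K p] [PerfectField K] [DecidableEq K]
    (s₀ : State (Fin 3) K), IsRoot (p ^ e) s₀ → ∀ W : ForcedWalk (p ^ e) s₀, (∀ i, 1 ≤ (W.st i).shade) →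
    ∀ N : ℕ, (∀ t, N ≤ t → (W.st (t + 1)).shade = (W.st t).shade) →
    (∀ t, N ≤ t → ordZero (W.st t).F ≠ ((p ^ e : ℕ) : ℕ∞)) →
    (∀ M : ℕ, ∃ t, M ≤ t ∧ StaysOnNewest W t) → (∀ M : ℕ, ∃ t, M ≤ t ∧ W.b t ≠ 0) →
    (∀ (k : Fin 3) (N' : ℕ), ∃ t, N' ≤ t ∧ (W.j t = k ∨ W.b t k ≠ 0)) →
    (∀ t, N ≤ t → (ifp W (t + 1)).muTilde (p ^ e) = (ifp W t).muTilde (p ^ e)) →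
    (∀ t, N ≤ t → VertexLawAt W t) → (∀ t, N ≤ t → OriginLawAt W t) →
    (∀ t, N ≤ t → (ifp W t).muTilde (p ^ e) = 0) → False

/-- **LEAF C · THE POSITIVE ON-CONE REGIME (UNDECIDED, THE located residual of the non-monomial case):** vertex-bound
skew stalled tails with `μ̃ ≡ c > 0` from `N` on; by the law every late move is ON-CONE for every minimiser (binder
`¬ OffConeAt`, in force).  [new] -/
def NoPositiveOnConeSkewStalledTailsDeep : Prop :=
  ∀ p : ℕ, p.Prime → ∀ e : ℕ, 2 ≤ e → ∀ (K : Type) [Field K] [CharP K p] [PerfectField K] [DecidableEq K]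
    (s₀ : State (Fin 3) K), IsRoot (p ^ e) s₀ → ∀ W : ForcedWalk (p ^ e) s₀, (∀ i, 1 ≤ (W.st i).shade) →
    ∀ N : ℕ, (∀ t, N ≤ t → (W.st (t + 1)).shade = (W.st t).shade) →
    (∀ t, N ≤ t → ordZero (W.st t).F ≠ ((p ^ e : ℕ) : ℕ∞)) →
    (∀ M : ℕ, ∃ t, M ≤ t ∧ StaysOnNewest W t) → (∀ M : ℕ, ∃ t, M ≤ t ∧ W.b t ≠ 0) →
    (∀ (k : Fin 3) (N' : ℕ), ∃ t, N' ≤ t ∧ (W.j t = k ∨ W.b t k ≠ 0)) →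
    (∀ t, N ≤ t → (ifp W (t + 1)).muTilde (p ^ e) = (ifp W t).muTilde (p ^ e)) →
    (∀ t, N ≤ t → VertexLawAt W t) → (∀ t, N ≤ t → OriginLawAt W t) →
    (∀ t, N ≤ t → (0 : WithTop ℚ) < (ifp W t).muTilde (p ^ e)) → (∀ t, N ≤ t → ¬ OffConeAt W t) → False

/-- **The split beneath the residual is EXACT:** residual `↔` monomial leaf `∧` positive on-cone leaf
(trichotomy of the settled value of `μ̃ ≥ 0`; the on-cone binder is supplied by `not_offConeAt_of_stall_pos`). [folklore] -/
theorem vertexBound_iff_monomial_onCone :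
    NoVertexBoundSkewStalledTailsDeep ↔ NoMonomialSkewStalledTailsDeep ∧ NoPositiveOnConeSkewStalledTailsDeep := by
  constructor
  · intro h
    exact ⟨fun p hp e he K _ _ _ _ s₀ hs W hsh N hplat hexc hS hT hskew hst hV hO _ =>
        h p hp e he K s₀ hs W hsh N hplat hexc hS hT hskew hst hV hO,
      fun p hp e he K _ _ _ _ s₀ hs W hsh N hplat hexc hS hT hskew hst hV hO _ _ =>
        h p hp e he K s₀ hs W hsh N hplat hexc hS hT hskew hst hV hO⟩
  · rintro ⟨hM, hC⟩ p hp e he K _ _ _ _ s₀ hs W hsh N hplat hexc hS hT hskew hst hV hO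
    by_cases h0 : (ifp W N).muTilde (p ^ e) = 0
    · exact hM p hp e he K s₀ hs W hsh N hplat hexc hS hT hskew hst hV hO
        fun t ht => by rw [muTilde_eq_of_stall W hst ht, h0]
    · have hpos : ∀ t, N ≤ t → (0 : WithTop ℚ) < (ifp W t).muTilde (p ^ e) := fun t ht => by
        rw [muTilde_eq_of_stall W hst ht]
        exact lt_of_le_of_ne (muTilde_nonneg W N) (Ne.symm h0)
      exact hC p hp e he K s₀ hs W hsh N hplat hexc hS hT hskew hst hV hO hpos
        fun t ht => not_offConeAt_of_stall_pos hp hs W t (hst t ht).ge (hpos t ht)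

end Classes

end Summit.ResolutionOfSingularities.ResolutionOfSingularities.Theorems.StallVertex
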